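import Mathlib.Analysis.Complex.Basic
import Mathlib.Analysis.SpecialFunctions.Pow.Real
import Mathlib.Analysis.InnerProductSpace.PiL2
import Mathlib.LinearAlgebra.Matrix.NonsingularInverse
import Mathlib.LinearAlgebra.Matrix.Notation
import Mathlib.LinearAlgebra.Matrix.Trace
import HarnessLib

/-!
# Regular elliptic orbits in `U(2,1)`: the Hilbert–Schmidt radius along `y ↦ y γ y⁻¹` controls the SQUARE of the Hilbert–Schmidt radius of `y`
# (orbit HS-balls of radius `R` lie in group HS-balls of radius `≍ √R`; the `N = 3` twin of ★ `ArchEllipticOrbitHSBall`, sharp at the `e = 1` scale)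

Topic `NumberTheory/Rogawski1990`; namespace `Literature.NumberTheory.Rogawski1990`.  THEOREMS ONLY (no `def`, no instance, no notation, no axiom, no named fact,
no `sorry`).  Cell `pub/hodgecm-mathlib`, crux H413 (`stmt-HodgeConjecture-24833`), programme F0∕P3c «GO 500» half A, line LH2 (`stub_N8`; letters O1″ «Shelstad,
Schwartz-valued transfer» ∕ O3″ «Bouaziz replacement», both about the class ★ `ArchSchwartzOn L 3 Φ₃ 1` on `G_∞ = U(Φ₃)(L⁺ ⊗ ℝ) = U(2,1)^d`); seat LH2-p02 (g2).
COUNT-NEUTRAL (VOL) kit: the geometric input of Harish-Chandra's volume growth of a regular elliptic orbit of `U(2,1)` in the Hilbert–Schmidt weight, which feeds the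
orbital-integral convergence lemma ★ `integrable_orbitalIntegrand_of_archSchwartzOn_antidiagOne_of_volumeGrowth` (p848851) at the exponent `e = 1`; it restates no
clause of (14.2.1) and opens no layer-2 vocabulary.  Plain `3 × 3` complex matrices throughout, tokens of ★ `ArchUnitaryThreeEigenframeCompact` (p848127): the form
`Φ₃ = antidiag(1,1,1)` spelled `Matrix.of fun i j : Fin 3 => if i.val + j.val + 1 = 3 then 1 else 0`, unitarity `(y.map conj)ᵀ Φ₃ y = Φ₃` (membership in
★ `unitaryGroupOfForm (starRingEnd ℂ) Φ₃` = ★ `archLocal L 3 Φ₃ w`), and the compact-Cartan representative `γ = M(u₀,u₁,u₂) = !![(u₀+u₂)∕2, 0, (u₀−u₂)∕2; 0, u₁, 0;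
(u₀−u₂)∕2, 0, (u₀+u₂)∕2]` (every regular elliptic element of `U(Φ₃)(ℂ)` is `U(Φ₃)`-conjugate to one, ★ p848127 §3).

THE MATHEMATICS.  Let `h(v, w) = v̄ᵀ Φ₃ w` (signature `(2,1)`), `P = (p₀ p₁ p₂) = (1,0,1; 0,1,0; 1,0,−1)` the common eigenframe of `Φ₃` and of every `M(u)`
(`h`-norms `D = Pᵀ Φ₃ P = diag(2, 1, −2)`; `M(u) pᵢ = uᵢ pᵢ`; `p₂` is the NEGATIVE eigenvector), `D′ = D⁻¹`.  For `Φ₃`-unitary `y` put `V = yP` (the frame `vᵢ = y pᵢ`) and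
`G = Vᴴ V = P yᴴ y P` (its Euclidean Gram matrix).  Then:
* `y⁻¹ = Φ₃ yᴴ Φ₃`, `y Φ₃ yᴴ = Φ₃` (§2); `V D′ Vᴴ = y (P D′ P) yᴴ = y Φ₃ yᴴ = Φ₃`, hence **`G D′ G D′ = 1`** (`frameGram_mul_dinv_mul_frameGram_mul_dinv`) — four scalar
  relations: `¼G₀₀² + ½|G₀₁|² − ¼|G₀₂|² = 1`, `½|G₀₁|² + G₁₁² − ½|G₁₂|² = 1`, `¼G₂₂² − ¼|G₀₂|² − ½|G₁₂|² = 1`, `G₀₁(½G₀₀ + G₁₁) = ½ G₀₂ Ḡ₁₂`; and Cauchy–Schwarz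
  `|G₀₁|² ≤ G₀₀ G₁₁`.
* `y M(u) y⁻¹ = V E Vᴴ Φ₃` with `E = diag(u₀∕2, u₁, −u₂∕2)`, so `‖y M(u) y⁻¹‖²_HS = tr(Ē G E G) = Σ_{ij} ēᵢ eⱼ |G_{ij}|²`, and with the diagonal relations
  **THE IDENTITY** `Σ_{ab} |(y M(u) y⁻¹)_{ab}|² = 3 − ½|u₀−u₁|²|G₀₁|² + ¼|u₀−u₂|²|G₀₂|² + ½|u₁−u₂|²|G₁₂|²` (`hs_conj_compactTorusRep₃_eq`; `|uᵢ| = 1`).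
* With `X₀ = ¼|G₀₂|²`, `X₁ = ½|G₁₂|²`, `W′ = ½|G₀₁|²`, `S = X₀ + X₁ = (G₂₂∕2)² − 1`: `W′ (½G₀₀ + G₁₁)² = X₀X₁` and `(½G₀₀ + G₁₁)² ≥ 2 + S` (Cauchy–Schwarz), so
  `W′ ≤ X₀X₁ ∕ (2 + S)`; the CHORD LEMMA `‖X₀(u₀−u₂) + X₁(u₁−u₂)‖ ≥ ½(X₀|u₀−u₂|² + X₁|u₁−u₂|²)` (a weighted chord of the unit circle through `u₀, u₁` stays away from
  the third point `u₂`) and `‖X₀(u₀−u₂) + X₁(u₁−u₂)‖² = (X₀|u₀−u₂|² + X₁|u₁−u₂|²) S − |u₀−u₁|² X₀X₁` give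
  **THE SHARP LOWER BOUND** `Σ_{ab} |(y M(u) y⁻¹)_{ab}|² ≥ 3 + (m∕2)² S`, `m = min(|u₀−u₂|², |u₁−u₂|²)` (`hs_conj_compactTorusRep₃_ge`), where `S = (‖y p₂‖²∕2)² − 1`
  (`= sinh² 2t` on `K a_t K`) and `‖y p₂‖² = Σ_k |y_{k0} − y_{k2}|²`.
* `Σ_{ab}|y_{ab}|² = ½(‖yp₀‖² + 2‖yp₁‖² + ‖yp₂‖²) ≤ (3∕2)‖yp₂‖²` (`hs_le_three_halves_frameNeg`; the positive frame vectors are shorter than the negative one), whence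
  **ORBIT HS-BALL ⊆ GROUP HS-BALL**: `Σ|(yγy⁻¹)_{ab}|² ≤ R ⇒ Σ|y_{ab}|² ≤ 3 √(1 + 4R∕m²)` for `u₂ ∉ {u₀, u₁}` (`hs_le_of_hs_conj_compactTorusRep₃_le`) — group HS²-radius
  `≍ √R`, so Harish-Chandra's `K A⁺ K` growth `vol{‖y‖²_HS ≤ ρ} ≍ ρ²` on `U(2,1)` yields LINEAR growth of the orbit in the HS weight, the exponent `e = 1` of
  ★ `ArchSchwartzOn L 3 Φ₃ 1`.  Only `u₂ ∉ {u₀, u₁}` is needed (`u₀ = u₁` allowed).  No Cartan decomposition and no spectral theorem are used.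
[BeuzartPlessis2020Asterisque, §1.2 (1.2.2) p. 21] compares `σ(g⁻¹Xg)` with `σ_{T∖G}(g)` for regular `X` in the same spirit (log-norms); here the comparison is an
explicit polynomial inequality for the compact Cartan of `U(2,1)`.
HONEST LABEL: HC_CM is proved only modulo the 7 printed citations (2 remaining: hLiu418 = stmt-HodgeConjecture-24832, h413 = stmt-HodgeConjecture-24833) until
rung 0 closes; this file closes no organ — it is the `G_∞`-side twin of ★ p848531, one brick of (VOL) at `e = 1`, itself A3-hardening of the letters O1″∕O3″ of `stub_N8`.

## References
* [BeuzartPlessis2020Asterisque] R. Beuzart-Plessis, *A local trace formula for the Gan–Gross–Prasad conjecture for unitary groups: the archimedean case*,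
  Astérisque 418 (2020), author version (held scan `paper:doi-10-24033-ast-1120`): §1.2 (1.2.2) p. 21 (`σ(g⁻¹Xg) ∼ σ_{T∖G}(g) + …` for regular `X`; p0022 L1–5),
  (1.2.4) p. 21 (Harish-Chandra's estimate `D^G(X)^{1∕2} ∫_{T∖G} ‖g⁻¹Xg‖^{−N} dg ≪ ‖X‖^{−N₀}`), §1.8 p. 39 (absolute convergence of `J_G(x, f)` for `f ∈ 𝒞(G(F))`).
* [Rogawski1990] J. D. Rogawski, *Automorphic Representations of Unitary Groups in Three Variables*, Ann. of Math. Stud. 123 (1990), §3.6 p. 28 (the Cartan subgroups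
  of a unitary group in three variables; type (1) = the compact torus `U(1)³`), §3.1 p. 19.
-/

set_option autoImplicit false

noncomputable section

open scoped Matrix ComplexConjugate

namespace Literature.NumberTheory.Rogawski1990

/-! ## §1 Numerics of the frame `P`, the form `Φ₃`, `D = PΦ₃P`, `D′ = D⁻¹`; chord lemma; the real inequality -/

section Numerics

/-- `Φ₃ = antidiag(1,1,1)` in matrix notation. [folklore] -/
private theorem antidiag3_eq_notation :
    (Matrix.of fun i j : Fin 3 => if i.val + j.val + 1 = 3 then (1 : ℂ) else 0) = !![0, 0, 1; 0, 1, 0; 1, 0, 0] := by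
  ext i j
  fin_cases i <;> fin_cases j <;> simp [Matrix.of_apply]

/-- `Φ₃ Φ₃ = 1`. [folklore] -/
private theorem antidiag3_mul_antidiag3 :
    (Matrix.of fun i j : Fin 3 => if i.val + j.val + 1 = 3 then (1 : ℂ) else 0) *
      (Matrix.of fun i j : Fin 3 => if i.val + j.val + 1 = 3 then (1 : ℂ) else 0) = 1 := by
  rw [antidiag3_eq_notation]
  ext i j
  fin_cases i <;> fin_cases j <;> simp [Matrix.mul_apply, Fin.sum_univ_three]

/-- `P Φ₃ P = D = diag(2, 1, −2)` for the frame `P = (1,0,1; 0,1,0; 1,0,−1)`. [folklore] -/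
private theorem frame_mul_antidiag3_mul_frame :
    (!![1, 0, 1; 0, 1, 0; 1, 0, -1] : Matrix (Fin 3) (Fin 3) ℂ) * (Matrix.of fun i j : Fin 3 => if i.val + j.val + 1 = 3 then (1 : ℂ) else 0) *
      !![1, 0, 1; 0, 1, 0; 1, 0, -1] = !![2, 0, 0; 0, 1, 0; 0, 0, -2] := by
  rw [antidiag3_eq_notation]
  ext i j
  fin_cases i <;> fin_cases j <;> simp [Matrix.mul_apply, Fin.sum_univ_three] <;> norm_num

/-- `P D′ P = Φ₃` with `D′ = diag(1∕2, 1, −1∕2)`. [folklore] -/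
private theorem frame_mul_dinv_mul_frame :
    (!![1, 0, 1; 0, 1, 0; 1, 0, -1] : Matrix (Fin 3) (Fin 3) ℂ) * !![(1 / 2 : ℂ), 0, 0; 0, 1, 0; 0, 0, -(1 / 2)] * !![1, 0, 1; 0, 1, 0; 1, 0, -1] =
      Matrix.of fun i j : Fin 3 => if i.val + j.val + 1 = 3 then (1 : ℂ) else 0 := by
  rw [antidiag3_eq_notation]
  ext i j
  fin_cases i <;> fin_cases j <;> simp [Matrix.mul_apply, Fin.sum_univ_three] <;> norm_num

/-- `D D′ = 1`. [folklore] -/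
private theorem d_mul_dinv :
    (!![2, 0, 0; 0, 1, 0; 0, 0, -2] : Matrix (Fin 3) (Fin 3) ℂ) * !![(1 / 2 : ℂ), 0, 0; 0, 1, 0; 0, 0, -(1 / 2)] = 1 := by
  ext i j
  fin_cases i <;> fin_cases j <;> simp [Matrix.mul_apply, Fin.sum_univ_three]

/-- The frame `P` is real symmetric: `Pᴴ = P`. [folklore] -/
private theorem conjTranspose_frame :
    (!![1, 0, 1; 0, 1, 0; 1, 0, -1] : Matrix (Fin 3) (Fin 3) ℂ)ᴴ = !![1, 0, 1; 0, 1, 0; 1, 0, -1] := by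
  ext i j
  fin_cases i <;> fin_cases j <;> simp [Matrix.conjTranspose_apply]

/-- `Φ₃ᴴ = Φ₃`. [folklore] -/
private theorem conjTranspose_antidiag3 :
    (Matrix.of fun i j : Fin 3 => if i.val + j.val + 1 = 3 then (1 : ℂ) else 0)ᴴ =
      Matrix.of fun i j : Fin 3 => if i.val + j.val + 1 = 3 then (1 : ℂ) else 0 := by
  rw [antidiag3_eq_notation]
  ext i j
  fin_cases i <;> fin_cases j <;> simp [Matrix.conjTranspose_apply]

/-- The compact-torus representative in the frame: `M(u₀,u₁,u₂) = P · diag(u₀∕2, u₁, −u₂∕2) · P · Φ₃`. [folklore] -/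
private theorem compactTorusRep₃_eq_frame (u₀ u₁ u₂ : ℂ) :
    (!![(u₀ + u₂) / 2, 0, (u₀ - u₂) / 2; 0, u₁, 0; (u₀ - u₂) / 2, 0, (u₀ + u₂) / 2] : Matrix (Fin 3) (Fin 3) ℂ) =
      (!![1, 0, 1; 0, 1, 0; 1, 0, -1] : Matrix (Fin 3) (Fin 3) ℂ) * Matrix.diagonal ![u₀ / 2, u₁, -(u₂ / 2)] * !![1, 0, 1; 0, 1, 0; 1, 0, -1] *
        (Matrix.of fun i j : Fin 3 => if i.val + j.val + 1 = 3 then (1 : ℂ) else 0) := by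
  rw [antidiag3_eq_notation]
  ext i j
  fin_cases i <;> fin_cases j <;> simp [Matrix.mul_apply, Fin.sum_univ_three, Matrix.diagonal, Matrix.vecHead, Matrix.vecTail] <;> ring

/-- `star (u₀∕2, u₁, −u₂∕2) = (ū₀∕2, ū₁, −ū₂∕2)`. [folklore] -/
private theorem star_frameDiag (u₀ u₁ u₂ : ℂ) :
    star (![u₀ / 2, u₁, -(u₂ / 2)] : Fin 3 → ℂ) = ![starRingEnd ℂ u₀ / 2, starRingEnd ℂ u₁, -(starRingEnd ℂ u₂ / 2)] := by
  funext i
  fin_cases i <;> simp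

/-- `tr(diag(d′) G diag(d) G) = Σ_{ij} d′ᵢ Gᵢⱼ dⱼ Gⱼᵢ`. [folklore] -/
private theorem trace_diagonal_mul_mul_diagonal_mul (d' d : Fin 3 → ℂ) (G : Matrix (Fin 3) (Fin 3) ℂ) :
    (Matrix.diagonal d' * G * Matrix.diagonal d * G).trace = ∑ i : Fin 3, ∑ j : Fin 3, d' i * G i j * d j * G j i := by
  simp only [Matrix.trace, Matrix.diag_apply]
  refine Finset.sum_congr rfl fun i _ => ?_
  rw [Matrix.mul_apply]
  refine Finset.sum_congr rfl fun j _ => ?_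
  rw [Matrix.mul_diagonal, Matrix.diagonal_mul]

/-- `Σ_{a,b} |M_{ab}|² = Re tr(Mᴴ M)` for a complex `3 × 3` matrix. [folklore] -/
private theorem sum_norm_sq_eq_re_trace (M : Matrix (Fin 3) (Fin 3) ℂ) :
    ∑ a : Fin 3, ∑ b : Fin 3, ‖M a b‖ ^ 2 = ((Mᴴ * M).trace).re := by
  simp only [Matrix.trace, Matrix.diag, Matrix.mul_apply, Matrix.conjTranspose_apply, Fin.sum_univ_three, Complex.add_re,
    Complex.mul_re, Complex.star_def, Complex.conj_re, Complex.conj_im, Complex.sq_norm, Complex.normSq_apply]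
  ring

/-- **Chord lemma**: for unit `u₀, u₁, u₂` and weights `X₀, X₁ ≥ 0`,
`‖X₀(u₀ − u₂) + X₁(u₁ − u₂)‖ ≥ (X₀|u₀ − u₂|² + X₁|u₁ − u₂|²) ∕ 2` — a weighted chord of the unit circle through `u₀, u₁` stays at distance
`≥ ½ min |uᵢ − u₂|²` from the third point `u₂` (`Re(ū₂ ·)` of the left side is `−` the right side). [folklore] -/
private theorem chord_norm_ge {u₀ u₁ u₂ : ℂ} (h₀ : ‖u₀‖ = 1) (h₁ : ‖u₁‖ = 1) (h₂ : ‖u₂‖ = 1) {X₀ X₁ : ℝ} (hX₀ : 0 ≤ X₀) (hX₁ : 0 ≤ X₁) :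
    (X₀ * ‖u₀ - u₂‖ ^ 2 + X₁ * ‖u₁ - u₂‖ ^ 2) / 2 ≤ ‖(X₀ : ℂ) * (u₀ - u₂) + (X₁ : ℂ) * (u₁ - u₂)‖ := by
  set z : ℂ := (X₀ : ℂ) * (u₀ - u₂) + (X₁ : ℂ) * (u₁ - u₂) with hz
  have hw : ‖starRingEnd ℂ u₂ * z‖ = ‖z‖ := by rw [norm_mul, Complex.norm_conj, h₂, one_mul]
  have e0 : ‖u₀‖ ^ 2 = u₀.re ^ 2 + u₀.im ^ 2 := by rw [Complex.sq_norm, Complex.normSq_apply]; ring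
  have e1 : ‖u₁‖ ^ 2 = u₁.re ^ 2 + u₁.im ^ 2 := by rw [Complex.sq_norm, Complex.normSq_apply]; ring
  have e2 : ‖u₂‖ ^ 2 = u₂.re ^ 2 + u₂.im ^ 2 := by rw [Complex.sq_norm, Complex.normSq_apply]; ring
  rw [h₀] at e0
  rw [h₁] at e1
  rw [h₂] at e2
  have d0 : ‖u₀ - u₂‖ ^ 2 = (u₀.re - u₂.re) ^ 2 + (u₀.im - u₂.im) ^ 2 := by
    rw [Complex.sq_norm, Complex.normSq_apply]; simp; ring
  have d1 : ‖u₁ - u₂‖ ^ 2 = (u₁.re - u₂.re) ^ 2 + (u₁.im - u₂.im) ^ 2 := by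
    rw [Complex.sq_norm, Complex.normSq_apply]; simp; ring
  have hre : (starRingEnd ℂ u₂ * z).re = -((X₀ * ‖u₀ - u₂‖ ^ 2 + X₁ * ‖u₁ - u₂‖ ^ 2) / 2) := by
    rw [d0, d1, hz]
    simp [Complex.mul_re, Complex.mul_im, Complex.conj_re, Complex.conj_im]
    nlinarith [e0, e1, e2]
  calc (X₀ * ‖u₀ - u₂‖ ^ 2 + X₁ * ‖u₁ - u₂‖ ^ 2) / 2 = -(starRingEnd ℂ u₂ * z).re := by rw [hre]; ring
    _ ≤ |(starRingEnd ℂ u₂ * z).re| := neg_le_abs _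
    _ ≤ ‖starRingEnd ℂ u₂ * z‖ := Complex.abs_re_le_norm _
    _ = ‖z‖ := hw

/-- `‖X₀(u₀ − u₂) + X₁(u₁ − u₂)‖² = (X₀|u₀−u₂|² + X₁|u₁−u₂|²)(X₀ + X₁) − |u₀ − u₁|² X₀ X₁` (polarisation). [folklore] -/
private theorem chord_norm_sq_eq (u₀ u₁ u₂ : ℂ) (X₀ X₁ : ℝ) :
    ‖(X₀ : ℂ) * (u₀ - u₂) + (X₁ : ℂ) * (u₁ - u₂)‖ ^ 2 =
      (X₀ * ‖u₀ - u₂‖ ^ 2 + X₁ * ‖u₁ - u₂‖ ^ 2) * (X₀ + X₁) - ‖u₀ - u₁‖ ^ 2 * X₀ * X₁ := by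
  have d0 : ‖u₀ - u₂‖ ^ 2 = (u₀.re - u₂.re) ^ 2 + (u₀.im - u₂.im) ^ 2 := by
    rw [Complex.sq_norm, Complex.normSq_apply]; simp; ring
  have d1 : ‖u₁ - u₂‖ ^ 2 = (u₁.re - u₂.re) ^ 2 + (u₁.im - u₂.im) ^ 2 := by
    rw [Complex.sq_norm, Complex.normSq_apply]; simp; ring
  have d2 : ‖u₀ - u₁‖ ^ 2 = (u₀.re - u₁.re) ^ 2 + (u₀.im - u₁.im) ^ 2 := by
    rw [Complex.sq_norm, Complex.normSq_apply]; simp; ring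
  rw [d0, d1, d2, Complex.sq_norm, Complex.normSq_apply]
  simp [Complex.mul_re, Complex.mul_im]
  ring

/-- **The real inequality behind the sharp bound.**  With `S = X₀ + X₁`, `T = A X₀ + B X₁ ≥ m S`: from `W′ p = X₀ X₁`, `p ≥ 2 + S`, the chord bound
`C X₀ X₁ ≤ T S − T²∕4` and `m ≤ 4` one gets `(m∕2)² S ≤ T − C W′`. [folklore] -/
private theorem core_ineq {A B C W' X₀ X₁ p m : ℝ} (hC : 0 ≤ C) (hW : 0 ≤ W') (hX₀ : 0 ≤ X₀) (hX₁ : 0 ≤ X₁)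
    (hm : 0 ≤ m) (hmA : m ≤ A) (hmB : m ≤ B) (hm4 : m ≤ 4) (hp : 2 + (X₀ + X₁) ≤ p) (hWp : W' * p = X₀ * X₁)
    (hchord : C * X₀ * X₁ ≤ (A * X₀ + B * X₁) * (X₀ + X₁) - (A * X₀ + B * X₁) ^ 2 / 4) :
    (m / 2) ^ 2 * (X₀ + X₁) ≤ A * X₀ + B * X₁ - C * W' := by
  set S := X₀ + X₁ with hS
  set T := A * X₀ + B * X₁ with hTdef
  have hS0 : 0 ≤ S := by positivity
  have hT : m * S ≤ T := by
    rw [hS, hTdef]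
    nlinarith [mul_nonneg (sub_nonneg.2 hmA) hX₀, mul_nonneg (sub_nonneg.2 hmB) hX₁]
  have hT0 : 0 ≤ T := le_trans (by positivity) hT
  -- `C W′ (2 + S) ≤ C W′ p = C X₀ X₁ ≤ T S − T²/4`
  have h1 : C * W' * (2 + S) ≤ T * S - T ^ 2 / 4 := by
    have h1a : C * W' * (2 + S) ≤ C * W' * p := mul_le_mul_of_nonneg_left hp (mul_nonneg hC hW)
    have h1b : C * W' * p = C * X₀ * X₁ := by rw [mul_assoc, hWp]; ring
    linarith [h1a, h1b, hchord]
  -- `(m/2)² S (2 + S) ≤ 2T + T²/4 ≤ (T − C W′)(2 + S)`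
  have hmS : m * m * (S * S) ≤ T * T := by
    have := mul_self_le_mul_self (by positivity : 0 ≤ m * S) hT
    nlinarith [this]
  have h2m : m * m * S ≤ 4 * (m * S) := by nlinarith [mul_nonneg hm hS0, hm4]
  have h2 : (m / 2) ^ 2 * S * (2 + S) ≤ (T - C * W') * (2 + S) := by nlinarith [h1, hT, hmS, h2m]
  have hpos : 0 < 2 + S := by linarith
  exact le_of_mul_le_mul_right h2 hpos

/-- The columns of the frame `V = yP`: `(y_{k0} + y_{k2}, y_{k1}, y_{k0} − y_{k2})`. [folklore] -/
private theorem frame_cols (M : Matrix (Fin 3) (Fin 3) ℂ) (k : Fin 3) :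
    (M * !![1, 0, 1; 0, 1, 0; 1, 0, -1] : Matrix (Fin 3) (Fin 3) ℂ) k 0 = M k 0 + M k 2 ∧ (M * !![1, 0, 1; 0, 1, 0; 1, 0, -1] : Matrix (Fin 3) (Fin 3) ℂ) k 1 = M k 1 ∧
      (M * !![1, 0, 1; 0, 1, 0; 1, 0, -1] : Matrix (Fin 3) (Fin 3) ℂ) k 2 = M k 0 - M k 2 := by
  refine ⟨?_, ?_, ?_⟩
  · rw [Matrix.mul_apply]; simp [Fin.sum_univ_three]
  · rw [Matrix.mul_apply]; simp [Fin.sum_univ_three]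
  · rw [Matrix.mul_apply]; simp [Fin.sum_univ_three, sub_eq_add_neg]

end Numerics

/-! ## §2 The frame Gram matrix of a `Φ₃`-unitary `y` and the identities along an elliptic orbit -/

section EllipticOrbitThree

variable {y : Matrix (Fin 3) (Fin 3) ℂ}
  (hy : (y.map (starRingEnd ℂ))ᵀ * (Matrix.of fun i j : Fin 3 => if i.val + j.val + 1 = 3 then (1 : ℂ) else 0) * y =
    (Matrix.of fun i j : Fin 3 => if i.val + j.val + 1 = 3 then (1 : ℂ) else 0))

include hy

/-- `yᴴ Φ₃ y = Φ₃` with Mathlib's conjugate transpose (`U_Φ = {g : ᵗḡ Φ g = Φ}` in the column convention of ★ `unitaryGroupOfForm`). [cite: Rogawski1990, §1.9 p. 8] -/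
theorem archThree_conjTranspose_mul_mul :
    yᴴ * (Matrix.of fun i j : Fin 3 => if i.val + j.val + 1 = 3 then (1 : ℂ) else 0) * y =
      (Matrix.of fun i j : Fin 3 => if i.val + j.val + 1 = 3 then (1 : ℂ) else 0) := by
  have h : yᴴ = (y.map (starRingEnd ℂ))ᵀ := by
    rw [Matrix.conjTranspose, Matrix.transpose_map]
    rfl
  rw [h]
  exact hy

/-- `Φ₃ yᴴ Φ₃ · y = 1` (`Φ₃² = 1`). [cite: Rogawski1990, §1.9 p. 8] -/
theorem archThree_conjAdj_mul_eq_one :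
    ((Matrix.of fun i j : Fin 3 => if i.val + j.val + 1 = 3 then (1 : ℂ) else 0) * yᴴ *
        (Matrix.of fun i j : Fin 3 => if i.val + j.val + 1 = 3 then (1 : ℂ) else 0)) * y = 1 := by
  calc ((Matrix.of fun i j : Fin 3 => if i.val + j.val + 1 = 3 then (1 : ℂ) else 0) * yᴴ *
        (Matrix.of fun i j : Fin 3 => if i.val + j.val + 1 = 3 then (1 : ℂ) else 0)) * y
      = (Matrix.of fun i j : Fin 3 => if i.val + j.val + 1 = 3 then (1 : ℂ) else 0) *
          (yᴴ * (Matrix.of fun i j : Fin 3 => if i.val + j.val + 1 = 3 then (1 : ℂ) else 0) * y) := by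
        simp only [Matrix.mul_assoc]
    _ = 1 := by rw [archThree_conjTranspose_mul_mul hy, antidiag3_mul_antidiag3]

/-- **`y⁻¹ = Φ₃ yᴴ Φ₃`** for `y ∈ U(Φ₃)(ℂ)`. [cite: Rogawski1990, §1.9 p. 8] -/
theorem archThree_inv_eq :
    y⁻¹ = (Matrix.of fun i j : Fin 3 => if i.val + j.val + 1 = 3 then (1 : ℂ) else 0) * yᴴ *
        (Matrix.of fun i j : Fin 3 => if i.val + j.val + 1 = 3 then (1 : ℂ) else 0) :=
  Matrix.inv_eq_left_inv (archThree_conjAdj_mul_eq_one hy)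

/-- **Row unitarity `y Φ₃ yᴴ = Φ₃`** — print's form `U_Φ = {g ∈ GL_n(E) : g Φ ᵗḡ = Φ}` of the membership condition. [cite: Rogawski1990, §1.9 p. 8] -/
theorem archThree_mul_mul_conjTranspose :
    y * (Matrix.of fun i j : Fin 3 => if i.val + j.val + 1 = 3 then (1 : ℂ) else 0) * yᴴ =
      (Matrix.of fun i j : Fin 3 => if i.val + j.val + 1 = 3 then (1 : ℂ) else 0) := by
  have h := mul_eq_one_comm.mp (archThree_conjAdj_mul_eq_one hy)
  have h2 := congrArg (· * (Matrix.of fun i j : Fin 3 => if i.val + j.val + 1 = 3 then (1 : ℂ) else 0)) h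
  simp only [Matrix.mul_assoc, antidiag3_mul_antidiag3, Matrix.mul_one, Matrix.one_mul] at h2
  simpa only [Matrix.mul_assoc] using h2

/-- **The frame Gram matrix `G = P yᴴ y P` satisfies `G D′ G D′ = 1`** (`V = yP` is an `h`-orthogonal frame with `h`-norms `(2, 1, −2)`: `V D′ Vᴴ = y Φ₃ yᴴ = Φ₃`). [folklore] -/
private theorem frameGram_mul_dinv_mul_frameGram_mul_dinv :
    ((!![1, 0, 1; 0, 1, 0; 1, 0, -1] : Matrix (Fin 3) (Fin 3) ℂ) * yᴴ * y * !![1, 0, 1; 0, 1, 0; 1, 0, -1]) *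
        !![(1 / 2 : ℂ), 0, 0; 0, 1, 0; 0, 0, -(1 / 2)] *
        ((!![1, 0, 1; 0, 1, 0; 1, 0, -1] : Matrix (Fin 3) (Fin 3) ℂ) * yᴴ * y * !![1, 0, 1; 0, 1, 0; 1, 0, -1]) *
        !![(1 / 2 : ℂ), 0, 0; 0, 1, 0; 0, 0, -(1 / 2)] = 1 := by
  set P : Matrix (Fin 3) (Fin 3) ℂ := !![1, 0, 1; 0, 1, 0; 1, 0, -1] with hP
  set Dinv : Matrix (Fin 3) (Fin 3) ℂ := !![(1 / 2 : ℂ), 0, 0; 0, 1, 0; 0, 0, -(1 / 2)] with hDinv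
  set Φ : Matrix (Fin 3) (Fin 3) ℂ := Matrix.of fun i j : Fin 3 => if i.val + j.val + 1 = 3 then (1 : ℂ) else 0 with hΦ
  have h1 : P * Dinv * P = Φ := frame_mul_dinv_mul_frame
  have h2 : y * Φ * yᴴ = Φ := archThree_mul_mul_conjTranspose hy
  have h3 : yᴴ * Φ * y = Φ := archThree_conjTranspose_mul_mul hy
  have h4 : P * Φ * P = !![2, 0, 0; 0, 1, 0; 0, 0, -2] := frame_mul_antidiag3_mul_frame
  have h5 : (!![2, 0, 0; 0, 1, 0; 0, 0, -2] : Matrix (Fin 3) (Fin 3) ℂ) * Dinv = 1 := d_mul_dinv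
  calc P * yᴴ * y * P * Dinv * (P * yᴴ * y * P) * Dinv
      = P * yᴴ * (y * (P * Dinv * P) * yᴴ) * y * P * Dinv := by simp only [Matrix.mul_assoc]
    _ = P * yᴴ * (y * Φ * yᴴ) * y * P * Dinv := by rw [h1]
    _ = P * yᴴ * Φ * y * P * Dinv := by rw [h2]
    _ = P * (yᴴ * Φ * y) * P * Dinv := by simp only [Matrix.mul_assoc]
    _ = P * Φ * P * Dinv := by rw [h3]
    _ = 1 := by rw [h4, h5]

omit hy in
/-- The frame Gram matrix is hermitian: `G j i = conj (G i j)`. [folklore] -/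
private theorem frameGram_conj (i j : Fin 3) :
    starRingEnd ℂ (((!![1, 0, 1; 0, 1, 0; 1, 0, -1] : Matrix (Fin 3) (Fin 3) ℂ) * yᴴ * y * !![1, 0, 1; 0, 1, 0; 1, 0, -1] :
        Matrix (Fin 3) (Fin 3) ℂ) i j) =
      ((!![1, 0, 1; 0, 1, 0; 1, 0, -1] : Matrix (Fin 3) (Fin 3) ℂ) * yᴴ * y * !![1, 0, 1; 0, 1, 0; 1, 0, -1] :
        Matrix (Fin 3) (Fin 3) ℂ) j i := by
  have hH : ((!![1, 0, 1; 0, 1, 0; 1, 0, -1] : Matrix (Fin 3) (Fin 3) ℂ) * yᴴ * y * !![1, 0, 1; 0, 1, 0; 1, 0, -1])ᴴ =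
      (!![1, 0, 1; 0, 1, 0; 1, 0, -1] : Matrix (Fin 3) (Fin 3) ℂ) * yᴴ * y * !![1, 0, 1; 0, 1, 0; 1, 0, -1] := by
    rw [Matrix.conjTranspose_mul, Matrix.conjTranspose_mul, Matrix.conjTranspose_mul, Matrix.conjTranspose_conjTranspose,
      conjTranspose_frame]
    simp only [Matrix.mul_assoc]
  have h := congrFun (congrFun hH j) i
  rw [Matrix.conjTranspose_apply] at h
  -- `h : star (G i j) = G j i`
  rw [← h]
  rfl

/-- **`y γ y⁻¹` in the frame**: `y M(u) y⁻¹ = (yP) · diag(u₀∕2, u₁, −u₂∕2) · (P yᴴ) · Φ₃` (`y⁻¹ = Φ₃ yᴴ Φ₃`, `P⁻¹ = D′PΦ₃`). [cite: Rogawski1990, §3.6 p. 28] -/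
theorem conj_compactTorusRep₃_eq_frame (u₀ u₁ u₂ : ℂ) :
    y * !![(u₀ + u₂) / 2, 0, (u₀ - u₂) / 2; 0, u₁, 0; (u₀ - u₂) / 2, 0, (u₀ + u₂) / 2] * y⁻¹ =
      y * !![1, 0, 1; 0, 1, 0; 1, 0, -1] * Matrix.diagonal ![u₀ / 2, u₁, -(u₂ / 2)] * !![1, 0, 1; 0, 1, 0; 1, 0, -1] * yᴴ *
        (Matrix.of fun i j : Fin 3 => if i.val + j.val + 1 = 3 then (1 : ℂ) else 0) := by
  rw [archThree_inv_eq hy, compactTorusRep₃_eq_frame]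
  have hΦΦ := antidiag3_mul_antidiag3
  calc y * ((!![1, 0, 1; 0, 1, 0; 1, 0, -1] : Matrix (Fin 3) (Fin 3) ℂ) * Matrix.diagonal ![u₀ / 2, u₁, -(u₂ / 2)] *
          !![1, 0, 1; 0, 1, 0; 1, 0, -1] * (Matrix.of fun i j : Fin 3 => if i.val + j.val + 1 = 3 then (1 : ℂ) else 0)) *
          ((Matrix.of fun i j : Fin 3 => if i.val + j.val + 1 = 3 then (1 : ℂ) else 0) * yᴴ *
            (Matrix.of fun i j : Fin 3 => if i.val + j.val + 1 = 3 then (1 : ℂ) else 0))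
      = y * (!![1, 0, 1; 0, 1, 0; 1, 0, -1] : Matrix (Fin 3) (Fin 3) ℂ) * Matrix.diagonal ![u₀ / 2, u₁, -(u₂ / 2)] *
          !![1, 0, 1; 0, 1, 0; 1, 0, -1] *
          ((Matrix.of fun i j : Fin 3 => if i.val + j.val + 1 = 3 then (1 : ℂ) else 0) *
            (Matrix.of fun i j : Fin 3 => if i.val + j.val + 1 = 3 then (1 : ℂ) else 0)) * yᴴ *
          (Matrix.of fun i j : Fin 3 => if i.val + j.val + 1 = 3 then (1 : ℂ) else 0) := by
        simp only [Matrix.mul_assoc]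
    _ = _ := by rw [hΦΦ, Matrix.mul_one]

/-- **THE IDENTITY along a regular elliptic orbit of `U(2,1)`**: for `Φ₃`-unitary `y`, `γ = M(u₀,u₁,u₂)` with `|uᵢ| = 1`, and the frame Gram entries
`G_{ij} = (y pᵢ)ᴴ (y pⱼ)` (`p₀ = (1,0,1)`, `p₁ = (0,1,0)`, `p₂ = (1,0,−1)`; `G = P yᴴ y P`),
`Σ_{ab} |(yγy⁻¹)_{ab}|² = 3 − ½|u₀−u₁|²|G₀₁|² + ¼|u₀−u₂|²|G₀₂|² + ½|u₁−u₂|²|G₁₂|²` — the `N = 3` analogue of ★ `hs_conj_torusMatrix_sub_smul_one`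
(`tr(MᴴM) = tr(Ē G E G)` and the diagonal relations of `G D′ G D′ = 1`).  SIGN PATTERN: the `G₀₁`-term enters with a MINUS sign because `p₀, p₁` span the POSITIVE plane of `h` (the compact `U(2)`-internal direction: `|G₀₁|²` is bounded, `≤ G₀₀G₁₁`, and is traded against `X₀X₁` by the `(0,1)` relation), while `G₀₂`, `G₁₂` pair a positive vector with the NEGATIVE one `p₂` (the non-compact directions, growing like `e^{4t}`); on `y = a_t` one gets `3 + |u₀ − u₂|² sinh² 2t`. [cite: BeuzartPlessis2020Asterisque, §1.2 (1.2.2) p. 21] [cite: Rogawski1990, §3.6 p. 28] -/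
theorem hs_conj_compactTorusRep₃_eq {u₀ u₁ u₂ : ℂ}
    (h₀ : starRingEnd ℂ u₀ * u₀ = 1) (h₁ : starRingEnd ℂ u₁ * u₁ = 1) (h₂ : starRingEnd ℂ u₂ * u₂ = 1) :
    ∑ a : Fin 3, ∑ b : Fin 3, ‖(y * !![(u₀ + u₂) / 2, 0, (u₀ - u₂) / 2; 0, u₁, 0; (u₀ - u₂) / 2, 0, (u₀ + u₂) / 2] * y⁻¹) a b‖ ^ 2 =
      3 - (1 / 2) * ‖u₀ - u₁‖ ^ 2 *
            ‖((!![1, 0, 1; 0, 1, 0; 1, 0, -1] : Matrix (Fin 3) (Fin 3) ℂ) * yᴴ * y * !![1, 0, 1; 0, 1, 0; 1, 0, -1] : Matrix (Fin 3) (Fin 3) ℂ) 0 1‖ ^ 2 +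
          (1 / 4) * ‖u₀ - u₂‖ ^ 2 *
            ‖((!![1, 0, 1; 0, 1, 0; 1, 0, -1] : Matrix (Fin 3) (Fin 3) ℂ) * yᴴ * y * !![1, 0, 1; 0, 1, 0; 1, 0, -1] : Matrix (Fin 3) (Fin 3) ℂ) 0 2‖ ^ 2 +
        (1 / 2) * ‖u₁ - u₂‖ ^ 2 *
            ‖((!![1, 0, 1; 0, 1, 0; 1, 0, -1] : Matrix (Fin 3) (Fin 3) ℂ) * yᴴ * y * !![1, 0, 1; 0, 1, 0; 1, 0, -1] : Matrix (Fin 3) (Fin 3) ℂ) 1 2‖ ^ 2 := by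
  -- the conjugate in the frame, and its adjoint
  have hM := conj_compactTorusRep₃_eq_frame hy u₀ u₁ u₂
  have hMh : (y * !![1, 0, 1; 0, 1, 0; 1, 0, -1] * Matrix.diagonal ![u₀ / 2, u₁, -(u₂ / 2)] * !![1, 0, 1; 0, 1, 0; 1, 0, -1] * yᴴ *
        (Matrix.of fun i j : Fin 3 => if i.val + j.val + 1 = 3 then (1 : ℂ) else 0))ᴴ =
      (Matrix.of fun i j : Fin 3 => if i.val + j.val + 1 = 3 then (1 : ℂ) else 0) * y * !![1, 0, 1; 0, 1, 0; 1, 0, -1] *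
        Matrix.diagonal ![starRingEnd ℂ u₀ / 2, starRingEnd ℂ u₁, -(starRingEnd ℂ u₂ / 2)] * !![1, 0, 1; 0, 1, 0; 1, 0, -1] * yᴴ := by
    rw [Matrix.conjTranspose_mul, Matrix.conjTranspose_mul, Matrix.conjTranspose_mul, Matrix.conjTranspose_mul,
      Matrix.conjTranspose_mul, Matrix.conjTranspose_conjTranspose, conjTranspose_antidiag3, conjTranspose_frame, Matrix.diagonal_conjTranspose,
      star_frameDiag]
    simp only [Matrix.mul_assoc]
  -- the Gram matrix, kept opaque
  obtain ⟨G, hG⟩ : ∃ G : Matrix (Fin 3) (Fin 3) ℂ, (!![1, 0, 1; 0, 1, 0; 1, 0, -1] : Matrix (Fin 3) (Fin 3) ℂ) * yᴴ * y * !![1, 0, 1; 0, 1, 0; 1, 0, -1] = G :=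
    ⟨_, rfl⟩
  have hΦΦ := antidiag3_mul_antidiag3
  -- `tr(Mᴴ M) = tr(Ē G E G)`
  have htr : ((y * !![1, 0, 1; 0, 1, 0; 1, 0, -1] * Matrix.diagonal ![u₀ / 2, u₁, -(u₂ / 2)] * !![1, 0, 1; 0, 1, 0; 1, 0, -1] * yᴴ *
        (Matrix.of fun i j : Fin 3 => if i.val + j.val + 1 = 3 then (1 : ℂ) else 0))ᴴ *
        (y * !![1, 0, 1; 0, 1, 0; 1, 0, -1] * Matrix.diagonal ![u₀ / 2, u₁, -(u₂ / 2)] * !![1, 0, 1; 0, 1, 0; 1, 0, -1] * yᴴ *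
        (Matrix.of fun i j : Fin 3 => if i.val + j.val + 1 = 3 then (1 : ℂ) else 0))).trace =
      (Matrix.diagonal ![starRingEnd ℂ u₀ / 2, starRingEnd ℂ u₁, -(starRingEnd ℂ u₂ / 2)] * G * Matrix.diagonal ![u₀ / 2, u₁, -(u₂ / 2)] * G).trace := by
    rw [hMh]
    set Φ : Matrix (Fin 3) (Fin 3) ℂ := Matrix.of fun i j : Fin 3 => if i.val + j.val + 1 = 3 then (1 : ℂ) else 0 with hΦ
    set P : Matrix (Fin 3) (Fin 3) ℂ := !![1, 0, 1; 0, 1, 0; 1, 0, -1] with hP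
    set E : Matrix (Fin 3) (Fin 3) ℂ := Matrix.diagonal ![u₀ / 2, u₁, -(u₂ / 2)] with hE
    set E' : Matrix (Fin 3) (Fin 3) ℂ := Matrix.diagonal ![starRingEnd ℂ u₀ / 2, starRingEnd ℂ u₁, -(starRingEnd ℂ u₂ / 2)] with hE'
    calc (Φ * y * P * E' * P * yᴴ * (y * P * E * P * yᴴ * Φ)).trace
        = (Φ * (y * P * E' * P * yᴴ * y * P * E * P * yᴴ * Φ)).trace := by simp only [Matrix.mul_assoc]
      _ = ((y * P * E' * P * yᴴ * y * P * E * P * yᴴ * Φ) * Φ).trace := Matrix.trace_mul_comm _ _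
      _ = ((y * P) * (E' * (P * yᴴ * y * P) * E * P * yᴴ)).trace := by simp only [Matrix.mul_assoc, hΦΦ, Matrix.mul_one]
      _ = ((E' * (P * yᴴ * y * P) * E * P * yᴴ) * (y * P)).trace := Matrix.trace_mul_comm _ _
      _ = (E' * G * E * G).trace := by rw [← hG]; simp only [Matrix.mul_assoc]
  -- the Gram relations `G D′ G D′ = 1`, diagonal entries, and hermitian symmetry
  have hGD : G * !![(1 / 2 : ℂ), 0, 0; 0, 1, 0; 0, 0, -(1 / 2)] * G * !![(1 / 2 : ℂ), 0, 0; 0, 1, 0; 0, 0, -(1 / 2)] = 1 := by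
    rw [← hG]
    exact frameGram_mul_dinv_mul_frameGram_mul_dinv hy
  have hc : ∀ i j : Fin 3, G j i = starRingEnd ℂ (G i j) := by
    intro i j
    rw [← hG]
    exact (frameGram_conj (y := y) i j).symm
  have r00 := congrFun (congrFun hGD 0) 0
  have r11 := congrFun (congrFun hGD 1) 1
  have r22 := congrFun (congrFun hGD 2) 2
  simp [Matrix.mul_apply, Fin.sum_univ_three] at r00 r11 r22
  rw [hc 0 1, hc 0 2] at r00
  rw [hc 0 1, hc 1 2] at r11
  rw [hc 0 2, hc 1 2] at r22
  -- assemble over `ℂ`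
  have key : ((y * !![1, 0, 1; 0, 1, 0; 1, 0, -1] * Matrix.diagonal ![u₀ / 2, u₁, -(u₂ / 2)] * !![1, 0, 1; 0, 1, 0; 1, 0, -1] * yᴴ *
        (Matrix.of fun i j : Fin 3 => if i.val + j.val + 1 = 3 then (1 : ℂ) else 0))ᴴ *
        (y * !![1, 0, 1; 0, 1, 0; 1, 0, -1] * Matrix.diagonal ![u₀ / 2, u₁, -(u₂ / 2)] * !![1, 0, 1; 0, 1, 0; 1, 0, -1] * yᴴ *
        (Matrix.of fun i j : Fin 3 => if i.val + j.val + 1 = 3 then (1 : ℂ) else 0))).trace =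
      ((3 - (1 / 2) * ‖u₀ - u₁‖ ^ 2 * ‖G 0 1‖ ^ 2 + (1 / 4) * ‖u₀ - u₂‖ ^ 2 * ‖G 0 2‖ ^ 2 + (1 / 2) * ‖u₁ - u₂‖ ^ 2 * ‖G 1 2‖ ^ 2 : ℝ) : ℂ) := by
    rw [htr, trace_diagonal_mul_mul_diagonal_mul]
    simp only [Fin.sum_univ_three, Matrix.cons_val_zero, Matrix.cons_val_one, Matrix.cons_val_two, Matrix.head_cons, Matrix.tail_cons]
    rw [hc 0 1, hc 0 2, hc 1 2]
    push_cast
    rw [← Complex.mul_conj' (G 0 1), ← Complex.mul_conj' (G 0 2), ← Complex.mul_conj' (G 1 2), ← Complex.mul_conj' (u₀ - u₁),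
      ← Complex.mul_conj' (u₀ - u₂), ← Complex.mul_conj' (u₁ - u₂), map_sub, map_sub, map_sub]
    linear_combination r00 + r11 + r22 +
      (G 0 0 * G 0 0 / 4 + G 0 1 * starRingEnd ℂ (G 0 1) / 2 - G 0 2 * starRingEnd ℂ (G 0 2) / 4) * h₀ +
      (G 1 1 * G 1 1 + G 0 1 * starRingEnd ℂ (G 0 1) / 2 - G 1 2 * starRingEnd ℂ (G 1 2) / 2) * h₁ +
      (G 2 2 * G 2 2 / 4 - G 0 2 * starRingEnd ℂ (G 0 2) / 4 - G 1 2 * starRingEnd ℂ (G 1 2) / 2) * h₂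
  rw [sum_norm_sq_eq_re_trace, hM, key, Complex.ofReal_re, ← hG]

omit hy in
/-- The frame Gram matrix as `(yP)ᴴ (yP)`. [folklore] -/
private theorem frameGram_eq_conjTranspose_mul :
    (!![1, 0, 1; 0, 1, 0; 1, 0, -1] : Matrix (Fin 3) (Fin 3) ℂ) * yᴴ * y * !![1, 0, 1; 0, 1, 0; 1, 0, -1] =
      (y * !![1, 0, 1; 0, 1, 0; 1, 0, -1])ᴴ * (y * !![1, 0, 1; 0, 1, 0; 1, 0, -1]) := by
  rw [Matrix.conjTranspose_mul, conjTranspose_frame]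
  simp only [Matrix.mul_assoc]

/-- **The five scalar relations of the frame `V = yP`** (`G = Vᴴ V`, `nᵢ = ‖v_i‖²`): the diagonal entries `(0,0)`, `(1,1)`, `(2,2)` of `G D′ G D′ = 1`,
the squared norm of its `(0,1)` entry, and Cauchy–Schwarz `|G₀₁|² ≤ n₀ n₁`. [folklore] -/
private theorem frame_relations :
    (∑ k : Fin 3, ‖(y * !![1, 0, 1; 0, 1, 0; 1, 0, -1] : Matrix (Fin 3) (Fin 3) ℂ) k 0‖ ^ 2) * (∑ k : Fin 3, ‖(y * !![1, 0, 1; 0, 1, 0; 1, 0, -1] : Matrix (Fin 3) (Fin 3) ℂ) k 0‖ ^ 2) / 4 +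
          ‖((!![1, 0, 1; 0, 1, 0; 1, 0, -1] : Matrix (Fin 3) (Fin 3) ℂ) * yᴴ * y * !![1, 0, 1; 0, 1, 0; 1, 0, -1] : Matrix (Fin 3) (Fin 3) ℂ) 0 1‖ ^ 2 / 2 -
        ‖((!![1, 0, 1; 0, 1, 0; 1, 0, -1] : Matrix (Fin 3) (Fin 3) ℂ) * yᴴ * y * !![1, 0, 1; 0, 1, 0; 1, 0, -1] : Matrix (Fin 3) (Fin 3) ℂ) 0 2‖ ^ 2 / 4 = 1 ∧
    ‖((!![1, 0, 1; 0, 1, 0; 1, 0, -1] : Matrix (Fin 3) (Fin 3) ℂ) * yᴴ * y * !![1, 0, 1; 0, 1, 0; 1, 0, -1] : Matrix (Fin 3) (Fin 3) ℂ) 0 1‖ ^ 2 / 2 +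
          (∑ k : Fin 3, ‖(y * !![1, 0, 1; 0, 1, 0; 1, 0, -1] : Matrix (Fin 3) (Fin 3) ℂ) k 1‖ ^ 2) * (∑ k : Fin 3, ‖(y * !![1, 0, 1; 0, 1, 0; 1, 0, -1] : Matrix (Fin 3) (Fin 3) ℂ) k 1‖ ^ 2) -
        ‖((!![1, 0, 1; 0, 1, 0; 1, 0, -1] : Matrix (Fin 3) (Fin 3) ℂ) * yᴴ * y * !![1, 0, 1; 0, 1, 0; 1, 0, -1] : Matrix (Fin 3) (Fin 3) ℂ) 1 2‖ ^ 2 / 2 = 1 ∧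
    (∑ k : Fin 3, ‖(y * !![1, 0, 1; 0, 1, 0; 1, 0, -1] : Matrix (Fin 3) (Fin 3) ℂ) k 2‖ ^ 2) * (∑ k : Fin 3, ‖(y * !![1, 0, 1; 0, 1, 0; 1, 0, -1] : Matrix (Fin 3) (Fin 3) ℂ) k 2‖ ^ 2) / 4 -
          ‖((!![1, 0, 1; 0, 1, 0; 1, 0, -1] : Matrix (Fin 3) (Fin 3) ℂ) * yᴴ * y * !![1, 0, 1; 0, 1, 0; 1, 0, -1] : Matrix (Fin 3) (Fin 3) ℂ) 0 2‖ ^ 2 / 4 -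
        ‖((!![1, 0, 1; 0, 1, 0; 1, 0, -1] : Matrix (Fin 3) (Fin 3) ℂ) * yᴴ * y * !![1, 0, 1; 0, 1, 0; 1, 0, -1] : Matrix (Fin 3) (Fin 3) ℂ) 1 2‖ ^ 2 / 2 = 1 ∧
    ‖((!![1, 0, 1; 0, 1, 0; 1, 0, -1] : Matrix (Fin 3) (Fin 3) ℂ) * yᴴ * y * !![1, 0, 1; 0, 1, 0; 1, 0, -1] : Matrix (Fin 3) (Fin 3) ℂ) 0 1‖ ^ 2 *
          ((∑ k : Fin 3, ‖(y * !![1, 0, 1; 0, 1, 0; 1, 0, -1] : Matrix (Fin 3) (Fin 3) ℂ) k 0‖ ^ 2) / 2 + ∑ k : Fin 3, ‖(y * !![1, 0, 1; 0, 1, 0; 1, 0, -1] : Matrix (Fin 3) (Fin 3) ℂ) k 1‖ ^ 2) ^ 2 =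
      ‖((!![1, 0, 1; 0, 1, 0; 1, 0, -1] : Matrix (Fin 3) (Fin 3) ℂ) * yᴴ * y * !![1, 0, 1; 0, 1, 0; 1, 0, -1] : Matrix (Fin 3) (Fin 3) ℂ) 0 2‖ ^ 2 *
          ‖((!![1, 0, 1; 0, 1, 0; 1, 0, -1] : Matrix (Fin 3) (Fin 3) ℂ) * yᴴ * y * !![1, 0, 1; 0, 1, 0; 1, 0, -1] : Matrix (Fin 3) (Fin 3) ℂ) 1 2‖ ^ 2 / 4 ∧
    ‖((!![1, 0, 1; 0, 1, 0; 1, 0, -1] : Matrix (Fin 3) (Fin 3) ℂ) * yᴴ * y * !![1, 0, 1; 0, 1, 0; 1, 0, -1] : Matrix (Fin 3) (Fin 3) ℂ) 0 1‖ ^ 2 ≤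
      (∑ k : Fin 3, ‖(y * !![1, 0, 1; 0, 1, 0; 1, 0, -1] : Matrix (Fin 3) (Fin 3) ℂ) k 0‖ ^ 2) * (∑ k : Fin 3, ‖(y * !![1, 0, 1; 0, 1, 0; 1, 0, -1] : Matrix (Fin 3) (Fin 3) ℂ) k 1‖ ^ 2) := by
  -- the frame `V = yP` and its Gram matrix `G = Vᴴ V`, kept opaque
  obtain ⟨V, hV⟩ : ∃ V : Matrix (Fin 3) (Fin 3) ℂ, y * !![1, 0, 1; 0, 1, 0; 1, 0, -1] = V := ⟨_, rfl⟩
  rw [hV]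
  have hGV : (!![1, 0, 1; 0, 1, 0; 1, 0, -1] : Matrix (Fin 3) (Fin 3) ℂ) * yᴴ * y * !![1, 0, 1; 0, 1, 0; 1, 0, -1] = Vᴴ * V := by
    rw [frameGram_eq_conjTranspose_mul, hV]
  obtain ⟨G, hG⟩ : ∃ G : Matrix (Fin 3) (Fin 3) ℂ, Vᴴ * V = G := ⟨_, rfl⟩
  rw [hGV, hG]
  -- Gram relations and symmetry
  have hGD : G * !![(1 / 2 : ℂ), 0, 0; 0, 1, 0; 0, 0, -(1 / 2)] * G * !![(1 / 2 : ℂ), 0, 0; 0, 1, 0; 0, 0, -(1 / 2)] = 1 := by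
    rw [← hG, ← hGV]
    exact frameGram_mul_dinv_mul_frameGram_mul_dinv hy
  have hc : ∀ i j : Fin 3, G j i = starRingEnd ℂ (G i j) := by
    intro i j
    rw [← hG, ← hGV]
    exact (frameGram_conj (y := y) i j).symm
  -- diagonal entries are the squared norms of the frame vectors
  have hdiag : ∀ i : Fin 3, G i i = ((∑ k : Fin 3, ‖V k i‖ ^ 2 : ℝ) : ℂ) := by
    intro i
    rw [← hG, Matrix.mul_apply]
    push_cast
    refine Finset.sum_congr rfl fun k _ => ?_
    rw [Matrix.conjTranspose_apply, Complex.star_def, Complex.conj_mul']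
  -- the scalar relations (entries `(0,0)`, `(1,1)`, `(2,2)`, `(0,1)` of `G D′ G D′ = 1`)
  have r00 := congrFun (congrFun hGD 0) 0
  have r11 := congrFun (congrFun hGD 1) 1
  have r22 := congrFun (congrFun hGD 2) 2
  have r01 := congrFun (congrFun hGD 0) 1
  simp [Matrix.mul_apply, Fin.sum_univ_three] at r00 r11 r22 r01
  rw [hc 0 1, hc 0 2] at r00
  rw [hc 0 1, hc 1 2] at r11
  rw [hc 0 2, hc 1 2] at r22
  rw [hc 1 2] at r01
  rw [hdiag 0] at r00 r01
  rw [hdiag 1] at r11 r01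
  rw [hdiag 2] at r22
  set n₀ : ℝ := ∑ k : Fin 3, ‖V k 0‖ ^ 2 with hn₀
  set n₁ : ℝ := ∑ k : Fin 3, ‖V k 1‖ ^ 2 with hn₁
  set n₂ : ℝ := ∑ k : Fin 3, ‖V k 2‖ ^ 2 with hn₂
  have hn₀0 : 0 ≤ n₀ := Finset.sum_nonneg fun k _ => by positivity
  have hn₁0 : 0 ≤ n₁ := Finset.sum_nonneg fun k _ => by positivity
  set W : ℝ := ‖G 0 1‖ ^ 2 with hW
  set X : ℝ := ‖G 0 2‖ ^ 2 with hX
  set Z : ℝ := ‖G 1 2‖ ^ 2 with hZ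
  have eW : G 0 1 * starRingEnd ℂ (G 0 1) = ((W : ℝ) : ℂ) := by rw [Complex.mul_conj', hW]; norm_cast
  have eX : G 0 2 * starRingEnd ℂ (G 0 2) = ((X : ℝ) : ℂ) := by rw [Complex.mul_conj', hX]; norm_cast
  have eZ : G 1 2 * starRingEnd ℂ (G 1 2) = ((Z : ℝ) : ℂ) := by rw [Complex.mul_conj', hZ]; norm_cast
  have eW' : starRingEnd ℂ (G 0 1) * G 0 1 = ((W : ℝ) : ℂ) := by rw [mul_comm]; exact eW
  have eX' : starRingEnd ℂ (G 0 2) * G 0 2 = ((X : ℝ) : ℂ) := by rw [mul_comm]; exact eX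
  have eZ' : starRingEnd ℂ (G 1 2) * G 1 2 = ((Z : ℝ) : ℂ) := by rw [mul_comm]; exact eZ
  -- (R0) (R1) (R2) as real equations
  have R0 : n₀ * n₀ / 4 + W / 2 - X / 4 = 1 := by
    have h : ((n₀ * n₀ / 4 + W / 2 - X / 4 : ℝ) : ℂ) = 1 := by
      push_cast
      linear_combination r00 - (1 / 2 : ℂ) * eW + (1 / 4 : ℂ) * eX
    exact_mod_cast h
  have R1 : W / 2 + n₁ * n₁ - Z / 2 = 1 := by
    have h : ((W / 2 + n₁ * n₁ - Z / 2 : ℝ) : ℂ) = 1 := by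
      push_cast
      linear_combination r11 - (1 / 2 : ℂ) * eW' + (1 / 2 : ℂ) * eZ
    exact_mod_cast h
  have R2 : n₂ * n₂ / 4 - X / 4 - Z / 2 = 1 := by
    have h : ((n₂ * n₂ / 4 - X / 4 - Z / 2 : ℝ) : ℂ) = 1 := by
      push_cast
      linear_combination r22 + (1 / 4 : ℂ) * eX' + (1 / 2 : ℂ) * eZ'
    exact_mod_cast h
  -- (R01): `G₀₁ (n₀/2 + n₁) = G₀₂ Ḡ₁₂ / 2`, hence `W (n₀/2 + n₁)² = X Z / 4`
  have R01 : W * (n₀ / 2 + n₁) ^ 2 = X * Z / 4 := by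
    have h : G 0 1 * (((n₀ / 2 + n₁ : ℝ) : ℂ)) = G 0 2 * starRingEnd ℂ (G 1 2) / 2 := by
      push_cast
      linear_combination r01
    have hn := congrArg (fun z : ℂ => ‖z‖ ^ 2) h
    simp only [norm_mul, norm_div, Complex.norm_real, Complex.norm_conj, Complex.norm_ofNat, mul_pow, div_pow] at hn
    rw [Real.norm_of_nonneg (by positivity : (0 : ℝ) ≤ n₀ / 2 + n₁)] at hn
    rw [hW, hX, hZ]
    linarith [hn]
  -- Cauchy–Schwarz on the frame: `W ≤ n₀ n₁`
  have CS : W ≤ n₀ * n₁ := by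
    let x₀ : EuclideanSpace ℂ (Fin 3) := WithLp.toLp 2 fun k => V k 0
    let x₁ : EuclideanSpace ℂ (Fin 3) := WithLp.toLp 2 fun k => V k 1
    have hin : inner ℂ x₀ x₁ = G 0 1 := by
      rw [← hG, Matrix.mul_apply, PiLp.inner_apply]
      refine Finset.sum_congr rfl fun k _ => ?_
      rw [Matrix.conjTranspose_apply]
      simp [x₀, x₁, mul_comm]
    have hx₀ : ‖x₀‖ ^ 2 = n₀ := by rw [EuclideanSpace.norm_sq_eq]
    have hx₁ : ‖x₁‖ ^ 2 = n₁ := by rw [EuclideanSpace.norm_sq_eq]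
    have hcs := norm_inner_le_norm (𝕜 := ℂ) x₀ x₁
    rw [hin] at hcs
    have h0 : 0 ≤ ‖G 0 1‖ := norm_nonneg _
    calc W = ‖G 0 1‖ ^ 2 := hW
      _ ≤ (‖x₀‖ * ‖x₁‖) ^ 2 := by gcongr
      _ = n₀ * n₁ := by rw [mul_pow, hx₀, hx₁]
  exact ⟨R0, R1, R2, R01, CS⟩

omit hy in
/-- **Parallelogram**: `Σ_{ab} |y_{ab}|² = (‖y p₀‖² + 2‖y p₁‖² + ‖y p₂‖²) ∕ 2` for the frame `p₀ = (1,0,1)`, `p₁ = (0,1,0)`, `p₂ = (1,0,−1)`. [folklore] -/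
private theorem hs_eq_frame_norms :
    ∑ a : Fin 3, ∑ b : Fin 3, ‖y a b‖ ^ 2 =
      ((∑ k : Fin 3, ‖(y * !![1, 0, 1; 0, 1, 0; 1, 0, -1] : Matrix (Fin 3) (Fin 3) ℂ) k 0‖ ^ 2) + 2 * (∑ k : Fin 3, ‖(y * !![1, 0, 1; 0, 1, 0; 1, 0, -1] : Matrix (Fin 3) (Fin 3) ℂ) k 1‖ ^ 2) +
        ∑ k : Fin 3, ‖(y * !![1, 0, 1; 0, 1, 0; 1, 0, -1] : Matrix (Fin 3) (Fin 3) ℂ) k 2‖ ^ 2) / 2 := by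
  have h : ∀ k : Fin 3, ∑ b : Fin 3, ‖y k b‖ ^ 2 =
      (‖(y * !![1, 0, 1; 0, 1, 0; 1, 0, -1] : Matrix (Fin 3) (Fin 3) ℂ) k 0‖ ^ 2 + 2 * ‖(y * !![1, 0, 1; 0, 1, 0; 1, 0, -1] : Matrix (Fin 3) (Fin 3) ℂ) k 1‖ ^ 2 + ‖(y * !![1, 0, 1; 0, 1, 0; 1, 0, -1] : Matrix (Fin 3) (Fin 3) ℂ) k 2‖ ^ 2) / 2 := by
    intro k
    obtain ⟨h0, h1, h2⟩ := frame_cols y k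
    rw [h0, h1, h2]
    simp only [Fin.sum_univ_three, Complex.sq_norm, Complex.normSq_apply, Complex.add_re, Complex.add_im, Complex.sub_re, Complex.sub_im]
    ring
  rw [Finset.sum_congr rfl fun k _ => h k]
  simp only [Finset.sum_div, Finset.sum_add_distrib, Finset.mul_sum, add_div]

/-- **GROUP RADIUS ≤ 3∕2 · HEIGHT**: for `Φ₃`-unitary `y`, `Σ_{ab} |y_{ab}|² ≤ (3∕2) · Σ_k |y_{k0} − y_{k2}|² = (3∕2) ‖y p₂‖²` — the positive frame vectors are
no longer than the negative one (`‖y p₀‖ ≤ ‖y p₂‖`, `2‖y p₁‖² ≤ ‖y p₂‖²… ` from the Gram relations; exact on `K a_t K`: `2 cosh 2t + 1 ≤ 3 cosh 2t`).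
[cite: BeuzartPlessis2020Asterisque, §1.2 pp. 19–21] -/
theorem hs_le_three_halves_frameNeg :
    ∑ a : Fin 3, ∑ b : Fin 3, ‖y a b‖ ^ 2 ≤ (3 / 2) * ∑ k : Fin 3, ‖y k 0 - y k 2‖ ^ 2 := by
  obtain ⟨R0, R1, R2, -, -⟩ := frame_relations hy
  rw [hs_eq_frame_norms]
  have hcol : ∑ k : Fin 3, ‖y k 0 - y k 2‖ ^ 2 = ∑ k : Fin 3, ‖(y * !![1, 0, 1; 0, 1, 0; 1, 0, -1] : Matrix (Fin 3) (Fin 3) ℂ) k 2‖ ^ 2 :=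
    Finset.sum_congr rfl fun k _ => by rw [(frame_cols y k).2.2]
  rw [hcol]
  -- make the frame and the Gram matrix opaque
  obtain ⟨V, hV⟩ : ∃ V : Matrix (Fin 3) (Fin 3) ℂ, (y * !![1, 0, 1; 0, 1, 0; 1, 0, -1] : Matrix (Fin 3) (Fin 3) ℂ) = V := ⟨_, rfl⟩
  obtain ⟨G, hG⟩ : ∃ G : Matrix (Fin 3) (Fin 3) ℂ, ((!![1, 0, 1; 0, 1, 0; 1, 0, -1] : Matrix (Fin 3) (Fin 3) ℂ) * yᴴ * y * !![1, 0, 1; 0, 1, 0; 1, 0, -1] : Matrix (Fin 3) (Fin 3) ℂ) = G := ⟨_, rfl⟩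
  rw [hV] at R0 R1 R2 ⊢
  rw [hG] at R0 R1 R2
  have hn₀0 : 0 ≤ ∑ k : Fin 3, ‖V k 0‖ ^ 2 := Finset.sum_nonneg fun k _ => pow_nonneg (norm_nonneg _) 2
  have hn₁0 : 0 ≤ ∑ k : Fin 3, ‖V k 1‖ ^ 2 := Finset.sum_nonneg fun k _ => pow_nonneg (norm_nonneg _) 2
  have hn₂0 : 0 ≤ ∑ k : Fin 3, ‖V k 2‖ ^ 2 := Finset.sum_nonneg fun k _ => pow_nonneg (norm_nonneg _) 2
  have hW : 0 ≤ ‖G 0 1‖ ^ 2 := pow_nonneg (norm_nonneg _) 2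
  have hX : 0 ≤ ‖G 0 2‖ ^ 2 := pow_nonneg (norm_nonneg _) 2
  have hZ : 0 ≤ ‖G 1 2‖ ^ 2 := pow_nonneg (norm_nonneg _) 2
  set n₀ : ℝ := ∑ k : Fin 3, ‖V k 0‖ ^ 2 with hn₀
  set n₁ : ℝ := ∑ k : Fin 3, ‖V k 1‖ ^ 2 with hn₁
  set n₂ : ℝ := ∑ k : Fin 3, ‖V k 2‖ ^ 2 with hn₂
  -- `n₀² ≤ n₂²` and `n₁² ≤ n₂²/4`, hence `n₀ ≤ n₂`, `n₁ ≤ n₂/2`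
  have h0 : n₀ * n₀ ≤ n₂ * n₂ := by linarith
  have h1 : n₁ * n₁ ≤ (n₂ / 2) * (n₂ / 2) := by linarith
  have h0' : n₀ ≤ n₂ := by nlinarith [h0, hn₀0, hn₂0]
  have h1' : n₁ ≤ n₂ / 2 := by nlinarith [h1, hn₁0, hn₂0]
  linarith

/-- **SHARP LOWER BOUND along a regular elliptic orbit of `U(2,1)`** (`y` `Φ₃`-unitary, `γ = M(u₀,u₁,u₂)`, `|uᵢ| = 1`):
`Σ_{ab} |(yγy⁻¹)_{ab}|² ≥ 3 + (m∕2)² · ((Σ_k |y_{k0} − y_{k2}|²)² ∕ 4 − 1)`, `m = min(|u₀−u₂|², |u₁−u₂|²)` — i.e. `‖yγy⁻¹‖²_HS − 3 ≥ (m∕2)² sinh²(2t)`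
for `y ∈ K a_t K`, since `Σ_k |y_{k0} − y_{k2}|² = ‖y p₂‖² = 2 cosh 2t` is the height of the image of the negative eigenvector `p₂ = (1,0,−1)`.  Proof: the identity
★ `hs_conj_compactTorusRep₃_eq`, the Gram relations `G D′ G D′ = 1` (diagonal and `(0,1)` entries), Cauchy–Schwarz `|G₀₁|² ≤ G₀₀ G₁₁`, and the chord lemma; no
Cartan decomposition is used.  Only `u₂ ∉ {u₀, u₁}` matters (`m > 0`); `u₀ = u₁` is allowed. [cite: BeuzartPlessis2020Asterisque, §1.2 (1.2.2), (1.2.4) p. 21; §1.8 p. 39]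
[cite: Rogawski1990, §3.6 p. 28] -/
theorem hs_conj_compactTorusRep₃_ge {u₀ u₁ u₂ : ℂ} (h₀ : ‖u₀‖ = 1) (h₁ : ‖u₁‖ = 1) (h₂ : ‖u₂‖ = 1) :
    3 + (min (‖u₀ - u₂‖ ^ 2) (‖u₁ - u₂‖ ^ 2) / 2) ^ 2 * ((∑ k : Fin 3, ‖y k 0 - y k 2‖ ^ 2) ^ 2 / 4 - 1) ≤
      ∑ a : Fin 3, ∑ b : Fin 3, ‖(y * !![(u₀ + u₂) / 2, 0, (u₀ - u₂) / 2; 0, u₁, 0; (u₀ - u₂) / 2, 0, (u₀ + u₂) / 2] * y⁻¹) a b‖ ^ 2 := by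
  have hu₀ : starRingEnd ℂ u₀ * u₀ = 1 := by rw [Complex.conj_mul', h₀]; norm_num
  have hu₁ : starRingEnd ℂ u₁ * u₁ = 1 := by rw [Complex.conj_mul', h₁]; norm_num
  have hu₂ : starRingEnd ℂ u₂ * u₂ = 1 := by rw [Complex.conj_mul', h₂]; norm_num
  rw [hs_conj_compactTorusRep₃_eq hy hu₀ hu₁ hu₂]
  obtain ⟨R0, R1, R2, R01, CS⟩ := frame_relations hy
  have hcol : ∑ k : Fin 3, ‖y k 0 - y k 2‖ ^ 2 = ∑ k : Fin 3, ‖(y * !![1, 0, 1; 0, 1, 0; 1, 0, -1] : Matrix (Fin 3) (Fin 3) ℂ) k 2‖ ^ 2 :=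
    Finset.sum_congr rfl fun k _ => by rw [(frame_cols y k).2.2]
  rw [hcol]
  -- make the frame and the Gram matrix opaque
  obtain ⟨V, hV⟩ : ∃ V : Matrix (Fin 3) (Fin 3) ℂ, (y * !![1, 0, 1; 0, 1, 0; 1, 0, -1] : Matrix (Fin 3) (Fin 3) ℂ) = V := ⟨_, rfl⟩
  obtain ⟨G, hG⟩ : ∃ G : Matrix (Fin 3) (Fin 3) ℂ, ((!![1, 0, 1; 0, 1, 0; 1, 0, -1] : Matrix (Fin 3) (Fin 3) ℂ) * yᴴ * y * !![1, 0, 1; 0, 1, 0; 1, 0, -1] : Matrix (Fin 3) (Fin 3) ℂ) = G := ⟨_, rfl⟩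
  rw [hV] at R0 R1 R2 R01 CS ⊢
  rw [hG] at R0 R1 R2 R01 CS ⊢
  have hW0 : 0 ≤ ‖G 0 1‖ ^ 2 := pow_nonneg (norm_nonneg _) 2
  have hX0 : 0 ≤ ‖G 0 2‖ ^ 2 := pow_nonneg (norm_nonneg _) 2
  have hZ0 : 0 ≤ ‖G 1 2‖ ^ 2 := pow_nonneg (norm_nonneg _) 2
  set n₀ : ℝ := ∑ k : Fin 3, ‖V k 0‖ ^ 2 with hn₀
  set n₁ : ℝ := ∑ k : Fin 3, ‖V k 1‖ ^ 2 with hn₁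
  set n₂ : ℝ := ∑ k : Fin 3, ‖V k 2‖ ^ 2 with hn₂
  set W : ℝ := ‖G 0 1‖ ^ 2 with hW
  set X : ℝ := ‖G 0 2‖ ^ 2 with hX
  set Z : ℝ := ‖G 1 2‖ ^ 2 with hZ
  have hp : 2 + (X / 4 + Z / 2) ≤ (n₀ / 2 + n₁) ^ 2 := by
    have e : (n₀ / 2 + n₁) ^ 2 = n₀ * n₀ / 4 + n₁ * n₁ + n₀ * n₁ := by ring
    rw [e]
    linarith [R0, R1, CS]
  have hWp : W / 2 * (n₀ / 2 + n₁) ^ 2 = X / 4 * (Z / 2) := by linear_combination R01 / 2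
  have hchord : ‖u₀ - u₁‖ ^ 2 * (X / 4) * (Z / 2) ≤
      (‖u₀ - u₂‖ ^ 2 * (X / 4) + ‖u₁ - u₂‖ ^ 2 * (Z / 2)) * (X / 4 + Z / 2) - (‖u₀ - u₂‖ ^ 2 * (X / 4) + ‖u₁ - u₂‖ ^ 2 * (Z / 2)) ^ 2 / 4 := by
    have hge := chord_norm_ge h₀ h₁ h₂ (by positivity : (0 : ℝ) ≤ X / 4) (by positivity : (0 : ℝ) ≤ Z / 2)
    have heq := chord_norm_sq_eq u₀ u₁ u₂ (X / 4) (Z / 2)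
    have hT0 : 0 ≤ (X / 4 * ‖u₀ - u₂‖ ^ 2 + Z / 2 * ‖u₁ - u₂‖ ^ 2) / 2 := by positivity
    have hsq := pow_le_pow_left₀ hT0 hge 2
    rw [heq] at hsq
    have e : ((X / 4 * ‖u₀ - u₂‖ ^ 2 + Z / 2 * ‖u₁ - u₂‖ ^ 2) / 2) ^ 2 = (‖u₀ - u₂‖ ^ 2 * (X / 4) + ‖u₁ - u₂‖ ^ 2 * (Z / 2)) ^ 2 / 4 := by
      ring
    have e2 : (X / 4 * ‖u₀ - u₂‖ ^ 2 + Z / 2 * ‖u₁ - u₂‖ ^ 2) * (X / 4 + Z / 2) - ‖u₀ - u₁‖ ^ 2 * (X / 4) * (Z / 2) =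
        (‖u₀ - u₂‖ ^ 2 * (X / 4) + ‖u₁ - u₂‖ ^ 2 * (Z / 2)) * (X / 4 + Z / 2) - ‖u₀ - u₁‖ ^ 2 * (X / 4) * (Z / 2) := by ring
    rw [e, e2] at hsq
    linarith [hsq]
  have hm4 : min (‖u₀ - u₂‖ ^ 2) (‖u₁ - u₂‖ ^ 2) ≤ 4 := by
    have h : ‖u₀ - u₂‖ ≤ 2 := by
      calc ‖u₀ - u₂‖ ≤ ‖u₀‖ + ‖u₂‖ := norm_sub_le _ _
        _ = 2 := by rw [h₀, h₂]; norm_num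
    have h' : ‖u₀ - u₂‖ ^ 2 ≤ 4 := by nlinarith [h, norm_nonneg (u₀ - u₂)]
    exact (min_le_left _ _).trans h'
  have hC0 : 0 ≤ ‖u₀ - u₁‖ ^ 2 := by positivity
  have hW2 : 0 ≤ W / 2 := by linarith
  have hX4 : 0 ≤ X / 4 := by linarith
  have hZ2 : 0 ≤ Z / 2 := by linarith
  have hm0 : 0 ≤ min (‖u₀ - u₂‖ ^ 2) (‖u₁ - u₂‖ ^ 2) := le_min (by positivity) (by positivity)
  have core := core_ineq hC0 hW2 hX4 hZ2 hm0 (min_le_left _ _) (min_le_right _ _) hm4 hp hWp hchord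
  -- `S = X/4 + Z/2 = n₂²/4 − 1`
  have hS : X / 4 + Z / 2 = n₂ ^ 2 / 4 - 1 := by rw [sq]; linarith [R2]
  rw [hS] at core
  linarith [core]

/-- **ORBIT HS-BALLS OF A REGULAR ELLIPTIC CLASS OF `U(2,1)` LIE IN GROUP HS-BALLS OF RADIUS `≍ √R`** — the `N = 3` twin of ★ `hs_le_of_hs_conj_torusMatrix_le`:
if `Σ_{ab} |(y γ y⁻¹)_{ab}|² ≤ R` for `Φ₃`-unitary `y` and `γ = M(u₀,u₁,u₂)` with `|uᵢ| = 1`, `u₂ ∉ {u₀, u₁}`, then `Σ_{ab} |y_{ab}|² ≤ 3 √(1 + 4R ∕ m²)`,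
`m = min(|u₀−u₂|², |u₁−u₂|²)`.  With Harish-Chandra's `K A⁺ K` growth `vol{‖y‖²_HS ≤ ρ} ≍ ρ²` on `U(2,1)` this is the LINEAR volume growth of regular elliptic orbits in the
HS weight — the exponent `e = 1` of ★ `ArchSchwartzOn L 3 Φ₃ 1` ((VOL) for the `G_∞`-side letters O1″∕O3″ of `stub_N8`).  CONVENTIONS for the consumer: both sides are
SQUARED Hilbert–Schmidt norms, i.e. the place factor `Q = Σ|·|²` of ★ `archHSGL` itself (group side `Q(y) ≤ 3√(1 + 4 Q(yγy⁻¹)∕m²)`, a `P^{1∕2}`-comparison); the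
quadratic Haar growth `haar{Q ≤ ρ} ≲ ρ²` of `U(2,1)` that turns this into the `hgrp`∕`hplace` token `≤ C_γ R` is NOT proved here (next brick, (T3-out-G)), nor is the
product over places ((Π′-G)). [cite: BeuzartPlessis2020Asterisque, §1.2 (1.2.2), (1.2.4) p. 21; §1.8 p. 39] -/
theorem hs_le_of_hs_conj_compactTorusRep₃_le {u₀ u₁ u₂ : ℂ} (h₀ : ‖u₀‖ = 1) (h₁ : ‖u₁‖ = 1) (h₂ : ‖u₂‖ = 1) (h₀₂ : u₀ ≠ u₂) (h₁₂ : u₁ ≠ u₂) {R : ℝ}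
    (hR : ∑ a : Fin 3, ∑ b : Fin 3, ‖(y * !![(u₀ + u₂) / 2, 0, (u₀ - u₂) / 2; 0, u₁, 0; (u₀ - u₂) / 2, 0, (u₀ + u₂) / 2] * y⁻¹) a b‖ ^ 2 ≤ R) :
    ∑ a : Fin 3, ∑ b : Fin 3, ‖y a b‖ ^ 2 ≤ 3 * Real.sqrt (1 + 4 * R / (min (‖u₀ - u₂‖ ^ 2) (‖u₁ - u₂‖ ^ 2)) ^ 2) := by
  have hge := hs_conj_compactTorusRep₃_ge hy h₀ h₁ h₂
  have hle := hs_le_three_halves_frameNeg hy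
  set m : ℝ := min (‖u₀ - u₂‖ ^ 2) (‖u₁ - u₂‖ ^ 2) with hm
  set n₂ : ℝ := ∑ k : Fin 3, ‖y k 0 - y k 2‖ ^ 2 with hn₂
  have hn₂0 : 0 ≤ n₂ := Finset.sum_nonneg fun k _ => by positivity
  have hm0 : 0 < m := by
    have ha : 0 < ‖u₀ - u₂‖ := norm_pos_iff.mpr (sub_ne_zero.mpr h₀₂)
    have hb : 0 < ‖u₁ - u₂‖ := norm_pos_iff.mpr (sub_ne_zero.mpr h₁₂)
    exact lt_min (by positivity) (by positivity)
  -- `Σ|M|² ≥ 3` (the identity at `y`: the bound holds with the nonnegative `m`-term when `n₂² ≥ 4`; in general use `R ≥ Σ|M|² ≥ 3 + (m/2)²(n₂²/4 − 1)`)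
  have h1 : (m / 2) ^ 2 * (n₂ ^ 2 / 4 - 1) ≤ R - 3 := by linarith [hge, hR]
  -- hence `(m/2)² n₂²/4 ≤ R − 3 + (m/2)² ≤ R + m²/4`, i.e. `n₂² ≤ 4 + 16 (R − 3)/m² ≤ 4 (1 + 4R/m²)`
  have hm2 : 0 < m ^ 2 := by positivity
  have hR3 : 0 ≤ R - 3 + (m / 2) ^ 2 := by nlinarith [h1, sq_nonneg n₂]
  have h2 : n₂ ^ 2 ≤ 4 * (1 + 4 * R / m ^ 2) := by
    have hR0 : 0 ≤ R := by
      have : (0 : ℝ) ≤ ∑ a : Fin 3, ∑ b : Fin 3,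
          ‖(y * !![(u₀ + u₂) / 2, 0, (u₀ - u₂) / 2; 0, u₁, 0; (u₀ - u₂) / 2, 0, (u₀ + u₂) / 2] * y⁻¹) a b‖ ^ 2 :=
        Finset.sum_nonneg fun a _ => Finset.sum_nonneg fun b _ => by positivity
      linarith
    have key : m ^ 2 * n₂ ^ 2 ≤ m ^ 2 * (4 * (1 + 4 * R / m ^ 2)) := by
      have e : m ^ 2 * (4 * (1 + 4 * R / m ^ 2)) = 4 * m ^ 2 + 16 * R := by field_simp; ring
      rw [e]
      nlinarith [h1, hR0, hm2]
    exact le_of_mul_le_mul_left key hm2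
  have h3 : n₂ ≤ 2 * Real.sqrt (1 + 4 * R / m ^ 2) := by
    have hs : Real.sqrt (n₂ ^ 2) ≤ Real.sqrt (4 * (1 + 4 * R / m ^ 2)) := Real.sqrt_le_sqrt h2
    rw [Real.sqrt_sq hn₂0, Real.sqrt_mul (by norm_num : (0 : ℝ) ≤ 4), show Real.sqrt 4 = 2 by
      rw [show (4 : ℝ) = 2 ^ 2 by norm_num, Real.sqrt_sq (by norm_num : (0 : ℝ) ≤ 2)]] at hs
    exact hs
  calc ∑ a : Fin 3, ∑ b : Fin 3, ‖y a b‖ ^ 2 ≤ (3 / 2) * n₂ := hle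
    _ ≤ (3 / 2) * (2 * Real.sqrt (1 + 4 * R / m ^ 2)) := by gcongr
    _ = 3 * Real.sqrt (1 + 4 * R / m ^ 2) := by ring

end EllipticOrbitThree

end Literature.NumberTheory.Rogawski1990

end
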